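import Summits.CriticalPhenomena.PercolationContinuityZ3.Theorems.PercNearOneGluingNoHeavyLowerTailFaceBAtom
import Summits.CriticalPhenomena.PercolationContinuityZ3.Theorems.PercNearOneGluingNoHeavyLowerTailUnitGlueGeneral
import HarnessLib

/-!
# `NoHeavyLowerTail` (stmt-CriticalPhenomena-4575) — the FORMAL FACE of the `2 + (any law)` kernel when the second unit's ports all beat
# the witness: the two atom inequalities of regimes C and D (memo LF3-BETA-R §16a)

Support file (lemma factory `prim-lf-3` gen 11, seat g11; `--supports stmt-CriticalPhenomena-4575`).  No definitions, no named facts,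
no sorries.

Setting as in `faceB_atom` / `faceII_atom`: a core `w`, a block `Y ∌ b` glued (`L := glue_Y w`), a pair `{c, d}` disjoint from `Y`,
`wP := w[s(c,d) ↦ 1]`, `M := L[s(c,d) ↦ 1]`, `N := M[s(c,s₀) ↦ 1]` (`s₀ ∈ Y`), a witness `j`.  The face value of the atom `Y` is
`f_Y = (1−u)[μ_L(s₀b) − μ_L(jb)] + u[μ_N(cb) − μ_N(jb)]`, the split row of a vertex `v` at `Y` is `r_{v,Y} = (1−u)[μ_L(vb) − μ_L(jb)] + u[μ_M(vb) − μ_M(jb)]`.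
When the `K_u`-weakest port of the second unit beats `j` (regimes C, D of the memo) the certificate uses no `Q`-row at nonempty atoms:

* `faceD_atom` (regime D, certificate `(0,0)`): if the glued pair beats `j` in `wP` (`μ_{wP}(jb) ≤ μ_{wP}(cb)`, i.e. `α_P ≥ 0`) and `j` is at most as
  connected as some `y ∈ Y` in the mixture `(1−u)·w + u·wP`, then `0 ≤ f_Y`.  Proof: `μ_N(jb) ≤ μ_N(cb)` (Lemma 5 `stub_gluingLemma5` in `wP` with the
  block `Y ∪ {c}`, `real_openConn_glue_insert`); if `μ_L(jb) ≤ μ_L(s₀b)` this already gives `f_Y ≥ 0`; otherwise the anchored exchange (`anchoredExchange`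
  in `L`, pair `{c,d}`, `v = s₀ ≤ j`) gives the merge-gain comparison `D ≥ 0`, i.e. `f_Y ≥ r_{s₀,Y}`, and `r_{s₀,Y} ≥ 0` is Lemma 5 in the mixture.
* `faceC_atom` (regime C, certificate `(1,0)`): if the glued pair does NOT beat `j` in `wP` (`μ_{wP}(cb) ≤ μ_{wP}(jb)`, regime-B hypothesis) and
  `μ_w(cb) ≤ μ_w(yb)` for some `y ∈ Y`, then `r_{c,Y} ≤ f_Y`.  Proof: `f_Y − r_{c,Y} = (1−u)[μ_L(s₀b) − μ_L(cb)] + u·E_Y` with `E_Y ≥ 0` by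
  `anchoredExchange` (as in `faceB_atom`) and `μ_L(cb) ≤ μ_L(s₀b)` by Lemma 5 in `w`.
-/

namespace Summit.CriticalPhenomena.PercolationContinuityZ3.Theorems

open MeasureTheory Set ProbabilityTheory
open Literature.Probability.LatticeModels
open Literature.Probability.Percolation

noncomputable section
open Classical

namespace UpsetExchange

variable {n : ℕ}

/-- In a block-glued graph the union `⋃_{s ∈ S} {s ↔ b}` has the measure of `{s₀ ↔ b}` (`s₀ ∈ S`), provided every pair `s(s₀, s)`, `s ∈ S ∖ s₀`,
is sure. [folklore] -/
theorem real_biUnion_openConn_le_of_sure (g : Sym2 (Fin n) → unitInterval) (S : Finset (Fin n)) (s₀ b : Fin n)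
    (hsure : ∀ s ∈ S, s ≠ s₀ → g s(s₀, s) = 1) :
    (prodBernoulli g).real (⋃ s ∈ S, openConn s b) ≤ (prodBernoulli g).real (openConn s₀ b) := by
  have hsub : (⋃ s ∈ S, openConn s b : Set (BondConfig (Fin n))) ⊆ openConn s₀ b ∪ ⋃ s ∈ S, (openConn s₀ s)ᶜ := by
    intro ω hω
    rcases mem_iUnion₂.1 hω with ⟨s, hs, hsb⟩
    by_cases h0 : ω ∈ openConn s₀ s
    · exact Or.inl ((h0 : (openGraph ω).Reachable s₀ s).trans (hsb : (openGraph ω).Reachable s b))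
    · exact Or.inr (mem_iUnion₂.2 ⟨s, hs, h0⟩)
  have hnull : ∀ s ∈ S, (prodBernoulli g).real (openConn s₀ s)ᶜ = 0 := by
    intro s hs
    by_cases hss : s₀ = s
    · subst hss
      have : ((openConn s₀ s₀)ᶜ : Set (BondConfig (Fin n))) = ∅ := by
        ext ω; simp only [mem_compl_iff, mem_empty_iff_false, iff_false, not_not]
        exact (SimpleGraph.Reachable.refl s₀ : (openGraph ω).Reachable s₀ s₀)
      rw [this, measureReal_empty]
    · exact real_not_openConn_eq_zero_of_surePair g s₀ s hss (hsure s hs (fun h => hss h.symm))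
  calc (prodBernoulli g).real (⋃ s ∈ S, openConn s b)
      ≤ (prodBernoulli g).real (openConn s₀ b ∪ ⋃ s ∈ S, (openConn s₀ s)ᶜ) := measureReal_mono hsub (measure_ne_top _ _)
    _ ≤ (prodBernoulli g).real (openConn s₀ b) + (prodBernoulli g).real (⋃ s ∈ S, (openConn s₀ s)ᶜ) := measureReal_union_le _ _
    _ ≤ (prodBernoulli g).real (openConn s₀ b) + ∑ s ∈ S, (prodBernoulli g).real (openConn s₀ s)ᶜ := by
        gcongr; exact measureReal_biUnion_finset_le S _
    _ = (prodBernoulli g).real (openConn s₀ b) := by rw [Finset.sum_eq_zero hnull, add_zero]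

/-- The merge-gain identity behind the last gluing `N = M[s(c,s₀) ↦ 1]`:
`μ_N(cb) − μ_N(jb) − μ_M(s₀b) + μ_M(jb) ≥ μ_M(cb, s₀↮b, j↮s₀) − μ_M(s₀b, c↮b, j↔c)` (in fact an equality). [folklore] -/
theorem mergeGain_diff_ge (M : Sym2 (Fin n) → unitInterval) (c s₀ j b : Fin n) (hcs₀ : c ≠ s₀) :
    (prodBernoulli M).real (openConn c b ∩ (openConn s₀ b)ᶜ ∩ (openConn j s₀)ᶜ) -
        (prodBernoulli M).real (openConn s₀ b ∩ (openConn c b)ᶜ ∩ openConn j c) ≤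
      ((prodBernoulli (fun f : Sym2 (Fin n) => if f = s(c, s₀) then 1 else M f)).real (openConn c b) -
          (prodBernoulli (fun f : Sym2 (Fin n) => if f = s(c, s₀) then 1 else M f)).real (openConn j b)) -
        ((prodBernoulli M).real (openConn s₀ b) - (prodBernoulli M).real (openConn j b)) := by
  set N : Sym2 (Fin n) → unitInterval := fun f => if f = s(c, s₀) then 1 else M f with hN
  have hmeas : ∀ X : Set (BondConfig (Fin n)), MeasurableSet X := fun _ => MeasurableSet.of_discrete
  have hI1 : (prodBernoulli N).real (openConn c b) =
      (prodBernoulli M).real (openConn c b) + (prodBernoulli M).real (openConn s₀ b ∩ (openConn c b)ᶜ) := by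
    rw [(real_openConn_pair_eq M hcs₀ b).1]
    have hset : openConn c b ∪ openConn s₀ b = openConn c b ∪ (openConn s₀ b ∩ (openConn c b)ᶜ : Set (BondConfig (Fin n))) := by
      ext ω; simp only [mem_union, mem_inter_iff, mem_compl_iff]; tauto
    rw [hset, measureReal_union _ ((hmeas _).inter (hmeas _))]
    exact Set.disjoint_left.2 fun ω h1 h2 => h2.2 h1
  have hI2 : (prodBernoulli N).real (openConn j b) ≤ (prodBernoulli M).real (openConn j b) +
      (prodBernoulli M).real (openConn s₀ b ∩ (openConn c b)ᶜ ∩ openConn j c) +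
      (prodBernoulli M).real (openConn c b ∩ (openConn s₀ b)ᶜ ∩ openConn j s₀) := by
    rw [real_openConn_pair_third M hcs₀ j b]
    have hsub : (openConn j b ∪ openConn j c ∩ openConn s₀ b ∪ openConn j s₀ ∩ openConn c b : Set (BondConfig (Fin n))) ⊆
        openConn j b ∪ (openConn s₀ b ∩ (openConn c b)ᶜ ∩ openConn j c) ∪ (openConn c b ∩ (openConn s₀ b)ᶜ ∩ openConn j s₀) := by
      rintro ω ((hjb | ⟨hjc, hsb⟩) | ⟨hjs, hcb⟩)
      · exact Or.inl (Or.inl hjb)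
      · by_cases hcb : ω ∈ openConn c b
        · exact Or.inl (Or.inl ((hjc : (openGraph ω).Reachable j c).trans (hcb : (openGraph ω).Reachable c b)))
        · exact Or.inl (Or.inr ⟨⟨hsb, hcb⟩, hjc⟩)
      · by_cases hsb : ω ∈ openConn s₀ b
        · exact Or.inl (Or.inl ((hjs : (openGraph ω).Reachable j s₀).trans (hsb : (openGraph ω).Reachable s₀ b)))
        · exact Or.inr ⟨⟨hcb, hsb⟩, hjs⟩
    calc (prodBernoulli M).real (openConn j b ∪ openConn j c ∩ openConn s₀ b ∪ openConn j s₀ ∩ openConn c b)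
        ≤ (prodBernoulli M).real (openConn j b ∪ (openConn s₀ b ∩ (openConn c b)ᶜ ∩ openConn j c) ∪
            (openConn c b ∩ (openConn s₀ b)ᶜ ∩ openConn j s₀)) := measureReal_mono hsub (measure_ne_top _ _)
      _ ≤ (prodBernoulli M).real (openConn j b ∪ (openConn s₀ b ∩ (openConn c b)ᶜ ∩ openConn j c)) +
            (prodBernoulli M).real (openConn c b ∩ (openConn s₀ b)ᶜ ∩ openConn j s₀) := measureReal_union_le _ _
      _ ≤ _ := by gcongr; exact measureReal_union_le _ _
  have hS1 := measureReal_inter_add_sdiff (μ := prodBernoulli M) (s := openConn c b) (hmeas (openConn s₀ b)) (measure_ne_top _ _)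
  have hS2 := measureReal_inter_add_sdiff (μ := prodBernoulli M) (s := openConn s₀ b) (hmeas (openConn c b)) (measure_ne_top _ _)
  have hS3 := measureReal_inter_add_sdiff (μ := prodBernoulli M) (s := openConn c b \ openConn s₀ b) (hmeas (openConn j s₀))
    (measure_ne_top _ _)
  have e12 : (openConn c b ∩ openConn s₀ b : Set (BondConfig (Fin n))) = openConn s₀ b ∩ openConn c b := Set.inter_comm _ _
  have e2 : (openConn s₀ b \ openConn c b : Set (BondConfig (Fin n))) = openConn s₀ b ∩ (openConn c b)ᶜ := rfl
  have e3a : ((openConn c b \ openConn s₀ b) ∩ openConn j s₀ : Set (BondConfig (Fin n))) =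
      openConn c b ∩ (openConn s₀ b)ᶜ ∩ openConn j s₀ := rfl
  have e3b : ((openConn c b \ openConn s₀ b) \ openConn j s₀ : Set (BondConfig (Fin n))) =
      openConn c b ∩ (openConn s₀ b)ᶜ ∩ (openConn j s₀)ᶜ := rfl
  rw [e12] at hS1
  rw [e2] at hS2
  rw [e3a, e3b] at hS3
  linarith

/-- **Regime D of the formal face, one nonempty atom**: `0 ≤ f_Y`.  See the module docstring.
[cite: KozmaNitzan2024, Question 9 (p. 36), Lemma 5 (p. 13), Lemma 3(i) (p. 6)] -/
theorem faceD_atom (w : Sym2 (Fin n) → unitInterval) (Y : Finset (Fin n)) (c d j b s₀ y : Fin n) (u : unitInterval)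
    (hs₀ : s₀ ∈ Y) (hy : y ∈ Y) (hcY : c ∉ Y) (hdY : d ∉ Y) (hbY : b ∉ Y) (hcd : c ≠ d) (hcb : c ≠ b)
    (hB0 : (prodBernoulli (fun f : Sym2 (Fin n) => if f = s(c, d) then 1 else w f)).real (openConn j b) ≤
      (prodBernoulli (fun f : Sym2 (Fin n) => if f = s(c, d) then 1 else w f)).real (openConn c b))
    (hjy : (1 - (u : ℝ)) * (prodBernoulli w).real (openConn j b) +
        (u : ℝ) * (prodBernoulli (fun f : Sym2 (Fin n) => if f = s(c, d) then 1 else w f)).real (openConn j b) ≤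
      (1 - (u : ℝ)) * (prodBernoulli w).real (openConn y b) +
        (u : ℝ) * (prodBernoulli (fun f : Sym2 (Fin n) => if f = s(c, d) then 1 else w f)).real (openConn y b)) :
    0 ≤ (1 - (u : ℝ)) *
        ((prodBernoulli (fun e : Sym2 (Fin n) => if (∀ x ∈ e, x ∈ Y) ∧ ¬ e.IsDiag then 1 else w e)).real (openConn s₀ b) -
          (prodBernoulli (fun e : Sym2 (Fin n) => if (∀ x ∈ e, x ∈ Y) ∧ ¬ e.IsDiag then 1 else w e)).real (openConn j b)) +
      (u : ℝ) *
        ((prodBernoulli (fun f : Sym2 (Fin n) => if f = s(c, s₀) then 1 else (if f = s(c, d) then 1 else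
            (if (∀ x ∈ f, x ∈ Y) ∧ ¬ f.IsDiag then 1 else w f)))).real (openConn c b) -
          (prodBernoulli (fun f : Sym2 (Fin n) => if f = s(c, s₀) then 1 else (if f = s(c, d) then 1 else
            (if (∀ x ∈ f, x ∈ Y) ∧ ¬ f.IsDiag then 1 else w f)))).real (openConn j b)) := by
  set L : Sym2 (Fin n) → unitInterval := fun e => if (∀ x ∈ e, x ∈ Y) ∧ ¬ e.IsDiag then 1 else w e with hL
  set M : Sym2 (Fin n) → unitInterval := fun f => if f = s(c, d) then 1 else L f with hM
  set N : Sym2 (Fin n) → unitInterval := fun f => if f = s(c, s₀) then 1 else M f with hN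
  set wP : Sym2 (Fin n) → unitInterval := fun f => if f = s(c, d) then 1 else w f with hwP
  have hcs₀ : c ≠ s₀ := fun h => hcY (h ▸ hs₀)
  have hu0 : 0 ≤ (u : ℝ) := unitInterval.nonneg u
  have hu1 : 0 ≤ 1 - (u : ℝ) := sub_nonneg.2 (unitInterval.le_one u)
  have hswap : (fun e : Sym2 (Fin n) => if (∀ x ∈ e, x ∈ Y) ∧ ¬ e.IsDiag then 1 else wP e) = M := by
    have h := glue_modifyPair_comm w Y (c := c) (d := d) hcY (fun _ => 1)
    simpa only [hwP, hM, hL] using h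
  -- (G1) `μ_N(jb) ≤ μ_N(cb)`: Lemma 5 in `wP` with the block `Y ∪ {c}`, read in `N`
  have hbcY : b ∉ insert c Y := by
    rw [Finset.mem_insert, not_or]; exact ⟨fun h => hcb h.symm, hbY⟩
  have hL5 := stub_gluingLemma5 n wP (insert c Y) j c b (Finset.mem_insert_self c Y) hbcY hB0
  have hUle := real_biUnion_openConn_le_of_sure
    (fun e : Sym2 (Fin n) => if (∀ x ∈ e, x ∈ insert c Y) ∧ ¬ e.IsDiag then 1 else wP e) (insert c Y) c b
    (fun s hs hsc => by
      have hin : (∀ x ∈ s(c, s), x ∈ insert c Y) ∧ ¬ (s(c, s)).IsDiag :=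
        ⟨fun x hx => by rcases Sym2.mem_iff.1 hx with rfl | rfl; exact Finset.mem_insert_self _ _; exact hs,
         by rw [Sym2.mk_isDiag_iff]; exact fun h => hsc h.symm⟩
      simp only [if_pos hin])
  have hkey : (fun f : Sym2 (Fin n) => if f = s(c, s₀) then (1 : unitInterval) else
      (if (∀ x ∈ f, x ∈ Y) ∧ ¬ f.IsDiag then 1 else wP f)) = N := by
    funext f
    simp only [hN, hM, hL, hwP]
    split_ifs <;> rfl
  have hconv : ∀ z : Fin n, (prodBernoulli (fun e : Sym2 (Fin n) => if (∀ x ∈ e, x ∈ insert c Y) ∧ ¬ e.IsDiag then 1 else wP e)).real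
      (openConn z b) = (prodBernoulli N).real (openConn z b) := by
    intro z
    rw [real_openConn_glue_insert wP Y c s₀ hs₀ hcY z b, hkey]
  have hNle : (prodBernoulli N).real (openConn j b) ≤ (prodBernoulli N).real (openConn c b) := by
    rw [← hconv j, ← hconv c]; exact hL5.trans hUle
  -- (L5 in the mixture) `r_{s₀,Y} ≥ 0`, i.e. `j ≤ s₀` in `(1−u)L + uM`
  set R₀ : Sym2 (Fin n) → unitInterval := fun f => if f = s(c, d) then Set.Icc.convexComb (w s(c, d)) 1 u else w f with hR₀
  set R : Sym2 (Fin n) → unitInterval := fun f => if f = s(c, d) then Set.Icc.convexComb (L s(c, d)) 1 u else L f with hR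
  have hswapR : (fun e : Sym2 (Fin n) => if (∀ x ∈ e, x ∈ Y) ∧ ¬ e.IsDiag then 1 else R₀ e) = R := by
    have h := glue_modifyPair_comm w Y (c := c) (d := d) hcY (fun t => Set.Icc.convexComb t 1 u)
    simpa only [hR₀, hR, hL] using h
  have hmixw : ∀ X : Set (BondConfig (Fin n)), (prodBernoulli R₀).real X =
      (1 - (u : ℝ)) * (prodBernoulli w).real X + (u : ℝ) * (prodBernoulli wP).real X :=
    fun X => real_raisePair_eq_mix w s(c, d) u X
  have hmixL : ∀ X : Set (BondConfig (Fin n)), (prodBernoulli R).real X =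
      (1 - (u : ℝ)) * (prodBernoulli L).real X + (u : ℝ) * (prodBernoulli M).real X :=
    fun X => real_raisePair_eq_mix L s(c, d) u X
  have hjyR : (prodBernoulli R₀).real (openConn j b) ≤ (prodBernoulli R₀).real (openConn y b) := by
    rw [hmixw, hmixw]; exact hjy
  have hL5' := stub_gluingLemma5 n R₀ Y j y b hy hbY hjyR
  rw [hswapR] at hL5'
  have hUle' := real_biUnion_openConn_le_of_sure R Y s₀ b (fun s hs hss => by
    have hne : s(s₀, s) ≠ s(c, d) := by
      intro h
      have : s₀ ∈ s(c, d) := h ▸ Sym2.mem_mk_left s₀ s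
      rcases Sym2.mem_iff.1 this with h1 | h1
      · exact hcY (h1 ▸ hs₀)
      · exact hdY (h1 ▸ hs₀)
    have hin : (∀ x ∈ s(s₀, s), x ∈ Y) ∧ ¬ (s(s₀, s)).IsDiag :=
      ⟨fun x hx => by rcases Sym2.mem_iff.1 hx with rfl | rfl <;> assumption, by rw [Sym2.mk_isDiag_iff]; exact fun h => hss h.symm⟩
    simp only [hR, hL, if_neg hne, if_pos hin])
  have hT1 : (1 - (u : ℝ)) * (prodBernoulli L).real (openConn j b) + (u : ℝ) * (prodBernoulli M).real (openConn j b) ≤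
      (1 - (u : ℝ)) * (prodBernoulli L).real (openConn s₀ b) + (u : ℝ) * (prodBernoulli M).real (openConn s₀ b) := by
    rw [← hmixL, ← hmixL]; exact hL5'.trans hUle'
  -- dichotomy on `s₀` versus `j` in `L`
  by_cases hzj : (prodBernoulli L).real (openConn s₀ b) ≤ (prodBernoulli L).real (openConn j b)
  · -- anchored exchange in `L`, pair `{c,d}`, `v = s₀ ≤ j`: the merge gain of `s₀` beats that of `j`
    have hE := anchoredExchange L ({c, d} : Finset (Fin n)) s₀ j b c (by simp) hzj
    rw [glue_pair_eq L hcd] at hE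
    have hD := mergeGain_diff_ge M c s₀ j b hcs₀
    have sNM := mul_le_mul_of_nonneg_left (le_trans (sub_nonneg.2 hE) hD) hu0
    nlinarith [sNM, hT1, hu0, hu1]
  · push Not at hzj
    nlinarith [hNle, hzj, hu0, hu1]

/-- **Regime C of the formal face, one nonempty atom**: `r_{c,Y} ≤ f_Y`.  See the module docstring.
[cite: KozmaNitzan2024, Question 9 (p. 36), Lemma 5 (p. 13), Lemma 3(i) (p. 6)] -/
theorem faceC_atom (w : Sym2 (Fin n) → unitInterval) (Y : Finset (Fin n)) (c d j b s₀ y : Fin n) (u : unitInterval)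
    (hs₀ : s₀ ∈ Y) (hy : y ∈ Y) (hcY : c ∉ Y) (hbY : b ∉ Y)
    (hB1 : (prodBernoulli (fun f : Sym2 (Fin n) => if f = s(c, d) then 1 else w f)).real (openConn c b) ≤
      (prodBernoulli (fun f : Sym2 (Fin n) => if f = s(c, d) then 1 else w f)).real (openConn j b))
    (hcy : (prodBernoulli w).real (openConn c b) ≤ (prodBernoulli w).real (openConn y b)) :
    (1 - (u : ℝ)) *
        ((prodBernoulli (fun e : Sym2 (Fin n) => if (∀ x ∈ e, x ∈ Y) ∧ ¬ e.IsDiag then 1 else w e)).real (openConn c b) -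
          (prodBernoulli (fun e : Sym2 (Fin n) => if (∀ x ∈ e, x ∈ Y) ∧ ¬ e.IsDiag then 1 else w e)).real (openConn j b)) +
      (u : ℝ) *
        ((prodBernoulli (fun f : Sym2 (Fin n) => if f = s(c, d) then 1 else
            (if (∀ x ∈ f, x ∈ Y) ∧ ¬ f.IsDiag then 1 else w f))).real (openConn c b) -
          (prodBernoulli (fun f : Sym2 (Fin n) => if f = s(c, d) then 1 else
            (if (∀ x ∈ f, x ∈ Y) ∧ ¬ f.IsDiag then 1 else w f))).real (openConn j b)) ≤
    (1 - (u : ℝ)) *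
        ((prodBernoulli (fun e : Sym2 (Fin n) => if (∀ x ∈ e, x ∈ Y) ∧ ¬ e.IsDiag then 1 else w e)).real (openConn s₀ b) -
          (prodBernoulli (fun e : Sym2 (Fin n) => if (∀ x ∈ e, x ∈ Y) ∧ ¬ e.IsDiag then 1 else w e)).real (openConn j b)) +
      (u : ℝ) *
        ((prodBernoulli (fun f : Sym2 (Fin n) => if f = s(c, s₀) then 1 else (if f = s(c, d) then 1 else
            (if (∀ x ∈ f, x ∈ Y) ∧ ¬ f.IsDiag then 1 else w f)))).real (openConn c b) -
          (prodBernoulli (fun f : Sym2 (Fin n) => if f = s(c, s₀) then 1 else (if f = s(c, d) then 1 else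
            (if (∀ x ∈ f, x ∈ Y) ∧ ¬ f.IsDiag then 1 else w f)))).real (openConn j b)) := by
  set L : Sym2 (Fin n) → unitInterval := fun e => if (∀ x ∈ e, x ∈ Y) ∧ ¬ e.IsDiag then 1 else w e with hL
  set M : Sym2 (Fin n) → unitInterval := fun f => if f = s(c, d) then 1 else L f with hM
  set wP : Sym2 (Fin n) → unitInterval := fun f => if f = s(c, d) then 1 else w f with hwP
  have hcs₀ : c ≠ s₀ := fun h => hcY (h ▸ hs₀)
  have hu0 : 0 ≤ (u : ℝ) := unitInterval.nonneg u
  have hu1 : 0 ≤ 1 - (u : ℝ) := sub_nonneg.2 (unitInterval.le_one u)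
  have hswap : (fun e : Sym2 (Fin n) => if (∀ x ∈ e, x ∈ Y) ∧ ¬ e.IsDiag then 1 else wP e) = M := by
    have h := glue_modifyPair_comm w Y (c := c) (d := d) hcY (fun _ => 1)
    simpa only [hwP, hM, hL] using h
  -- (E) anchored exchange, ranking `c ≤ j` in `wP`, block `Y` glued afterwards (`glue_Y wP = M`)
  have hT3 : (prodBernoulli M).real (openConn c b ∩ (openConn s₀ b)ᶜ ∩ openConn j s₀) ≤
      (prodBernoulli M).real (openConn s₀ b ∩ (openConn c b)ᶜ ∩ (openConn j c)ᶜ) := by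
    have h := anchoredExchange wP Y c j b s₀ hs₀ hB1
    rw [hswap] at h
    exact h
  -- `E_Y ≥ 0`: `μ_N(cb) − μ_N(jb) − μ_M(cb) + μ_M(jb) ≥ 0`
  have hD := mergeGain_diff_ge M c s₀ j b hcs₀
  have hmeas : ∀ X : Set (BondConfig (Fin n)), MeasurableSet X := fun _ => MeasurableSet.of_discrete
  have hS1 := measureReal_inter_add_sdiff (μ := prodBernoulli M) (s := openConn c b) (hmeas (openConn s₀ b)) (measure_ne_top _ _)
  have hS2 := measureReal_inter_add_sdiff (μ := prodBernoulli M) (s := openConn s₀ b) (hmeas (openConn c b)) (measure_ne_top _ _)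
  have hS3 := measureReal_inter_add_sdiff (μ := prodBernoulli M) (s := openConn c b \ openConn s₀ b) (hmeas (openConn j s₀))
    (measure_ne_top _ _)
  have hS4 := measureReal_inter_add_sdiff (μ := prodBernoulli M) (s := openConn s₀ b \ openConn c b) (hmeas (openConn j c))
    (measure_ne_top _ _)
  have e12 : (openConn c b ∩ openConn s₀ b : Set (BondConfig (Fin n))) = openConn s₀ b ∩ openConn c b := Set.inter_comm _ _
  have e3a : ((openConn c b \ openConn s₀ b) ∩ openConn j s₀ : Set (BondConfig (Fin n))) =
      openConn c b ∩ (openConn s₀ b)ᶜ ∩ openConn j s₀ := rfl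
  have e3b : ((openConn c b \ openConn s₀ b) \ openConn j s₀ : Set (BondConfig (Fin n))) =
      openConn c b ∩ (openConn s₀ b)ᶜ ∩ (openConn j s₀)ᶜ := rfl
  have e4a : ((openConn s₀ b \ openConn c b) ∩ openConn j c : Set (BondConfig (Fin n))) =
      openConn s₀ b ∩ (openConn c b)ᶜ ∩ openConn j c := rfl
  have e4b : ((openConn s₀ b \ openConn c b) \ openConn j c : Set (BondConfig (Fin n))) =
      openConn s₀ b ∩ (openConn c b)ᶜ ∩ (openConn j c)ᶜ := rfl
  rw [e12] at hS1
  rw [e3a, e3b] at hS3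
  rw [e4a, e4b] at hS4
  -- Lemma 5 in `w` with the block `Y`: `μ_L(cb) ≤ μ_L(s₀b)`
  have hL5 := stub_gluingLemma5 n w Y c y b hy hbY hcy
  have hUle := real_biUnion_openConn_le_of_sure L Y s₀ b (fun s hs hss => by
    have hin : (∀ x ∈ s(s₀, s), x ∈ Y) ∧ ¬ (s(s₀, s)).IsDiag :=
      ⟨fun x hx => by rcases Sym2.mem_iff.1 hx with rfl | rfl <;> assumption, by rw [Sym2.mk_isDiag_iff]; exact fun h => hss h.symm⟩
    simp only [hL, if_pos hin])
  have hLle : (prodBernoulli L).real (openConn c b) ≤ (prodBernoulli L).real (openConn s₀ b) := hL5.trans hUle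
  have sE := mul_le_mul_of_nonneg_left (show (0 : ℝ) ≤ ((prodBernoulli (fun f : Sym2 (Fin n) => if f = s(c, s₀) then 1 else M f)).real (openConn c b) -
          (prodBernoulli (fun f : Sym2 (Fin n) => if f = s(c, s₀) then 1 else M f)).real (openConn j b)) -
        ((prodBernoulli M).real (openConn c b) - (prodBernoulli M).real (openConn j b)) by
      linarith [hD, hT3, hS1, hS2, hS3, hS4, measureReal_nonneg (μ := prodBernoulli M)
        (s := openConn c b ∩ (openConn s₀ b)ᶜ ∩ (openConn j s₀)ᶜ)]) hu0
  have sL := mul_le_mul_of_nonneg_left (sub_nonneg.2 hLle) hu1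
  nlinarith [sE, sL, hu0, hu1]

end UpsetExchange

end

end Summit.CriticalPhenomena.PercolationContinuityZ3.Theorems
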